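import Literature.NumberTheory.LFunctions.ZetaArgVariation
import Literature.NumberTheory.LFunctions.RiemannSiegelStirling
import Literature.Analysis.Complex.WindingCertificate
import HarnessLib

/-!
# The exact zero count `N(T)` from a certified change of argument along `[½, 2] × {T}`

Trunk T-ANT (`NumberTheory/LFunctions`). Backlund's way of pinning down the number `N(T)` of
zeros of `ζ` with `0 < Im ρ ≤ T` *exactly* at one given height `T` (Backlund 1914 computed
`N(200) = 79` like this; Edwards §6.6, Titchmarsh Thm. 9.3): by the exact Riemann–von Mangoldt
formula

  `N(T) = θ(T)/π + 1 + S(T)`,  `π S(T) = Δ_{2 → 2+iT → ½+iT} arg ζ(s)`  (`T` not an ordinate),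

proved in the tree as `Literature.NumberTheory.LFunctions.pi_mul_zetaArgS_eq` (`ZetaArgVariation.lean`), it suffices to know
`θ(T)` to within a fraction (explicit Stirling bound `Literature.NumberTheory.LFunctions.abs_riemannSiegelTheta_sub_stirling_le`,
`RiemannSiegelStirling.lean`) and the change of `arg ζ` along the horizontal segment
`[½, 2] × {T}` to within `< π/2`. The latter is read off a *certified piece list*
(`Literature.Analysis.Complex.HPieces`, `WindingCertificate.lean`): a subdivision of the segment on each closed
piece of which `ζ` takes values in one of the four open coordinate half-planes — exactly what
validated interval evaluations of `ζ` deliver — whose signed quarter turns add up to the change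
of argument up to the principal argument of the value at `½ + iT` (`|·| < π/2`). On the
vertical leg `Re s = 2` nothing is to be computed (`Re ζ > 0` there).

This is the completeness input ("no zero below `T` has been missed") of certified zero
computations, in a form independent of Turing's method and of the bounds for `∫ S(t) dt`
(named facts in `TuringMethod.lean`); it is the one needed by the certificate interface of the
Odlyzko–te Riele computation (`MertensConjectureDisproofCertificate.lean`: `N(T) ≤ n` together
with `n` sign changes of `Z` below `T`).

## Main results (namespace `Literature`, all proved)

* `no_ordinate_of_ne_zero_on_segment` — if `ζ ≠ 0` on `[½, 1) × {T}` then no zero of `ζ` has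
  ordinate `T` (functional equation for `Re ρ < ½`).
* `im_I_mul_integral_logDeriv_zeta_two` — the vertical leg: `Im (i∫₀ᵀ ζ'/ζ(2+iy) dy) = arg ζ(2+iT)`.
* `abs_zetaZeroCount_sub_lt_of_hpieces` — for a valid piece list along `[½, 2] × {T}` ending with
  label `0`: `|N(T) − (θ(T)/π + 1 − turns/2)| < ½`.
* `zetaZeroCount_eq_of_hpieces`, `zetaZeroCount_eq_of_hpieces_stirling` — hence `N(T) = n` from an
  enclosure of `θ(T)`, resp. of the elementary Stirling main term `(T/2)log(T/2π) − T/2 − π/8`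
  (`T ≥ 2`, slack `2K(¼)/(πT)`, `K(¼) = stirlingVertRate (1/4)`).

## References

* [EdwardsZeta1974] H. M. Edwards, *Riemann's Zeta Function*, Academic Press 1974, §6.6
  (Backlund's evaluation of `N(T)`), §6.7.
* [Titchmarsh1986] E. C. Titchmarsh, *The Theory of the Riemann Zeta-Function*, 2nd ed., OUP
  1986, §9.3, Thm. 9.3 and (9.3.2).
* [Backlund1918] R. J. Backlund, *Über die Nullstellen der Riemannschen Zetafunktion*, Acta Math.
  41 (1918) 345–375 (and C. R. Acad. Sci. Paris 158 (1914) 1979–1981: `N(200) = 79`).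
-/

noncomputable section

open Complex Set MeasureTheory intervalIntegral Filter
open scoped Real Topology

namespace Literature.NumberTheory.LFunctions

open Literature.Analysis.Complex

/-! ## No zero of `ζ` has ordinate `T` once `ζ ≠ 0` on `[½, 1) × {T}` -/

/-- If `ζ` does not vanish on the segment `[½, 1) × {T}` (`T > 0`), then no zero of `ζ` has
imaginary part `T`: zeros with `Re ρ ≥ 1` do not exist, zeros with `Re ρ ≤ 0` are the trivial
ones (real), and a zero `ρ` with `0 < Re ρ < ½` would give the zero `1 - ρ̄` on the segment
(functional equation and `ζ(s̄) = conj ζ(s)`). [folklore] -/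
theorem no_ordinate_of_ne_zero_on_segment {T : ℝ} (hT : 0 < T)
    (h : ∀ x : ℝ, 1 / 2 ≤ x → x < 1 → riemannZeta (x + T * I) ≠ 0) :
    ∀ ρ : ℂ, riemannZeta ρ = 0 → ρ.im ≠ T := by
  intro ρ hζ hρT
  rcases le_or_gt 1 ρ.re with h1 | h1
  · exact riemannZeta_ne_zero_of_one_le_re h1 hζ
  rcases le_or_gt ρ.re 0 with h0 | h0
  · obtain ⟨n, hn⟩ := (riemannZeta_eq_zero_iff_of_re_nonpos h0).1 hζ
    have := congrArg Complex.im hn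
    simp at this
    linarith
  rcases le_or_gt (1 / 2) ρ.re with hh | hh
  · refine h ρ.re hh h1 ?_
    have : (ρ.re : ℂ) + T * I = ρ := by
      apply Complex.ext <;> simp [hρT]
    rwa [this]
  · -- reflect: `1 - conj ρ` is a zero with real part `1 - Re ρ ∈ (1/2, 1)` and ordinate `T`
    have hc : riemannZeta (starRingEnd ℂ ρ) = 0 := by rw [riemannZeta_conj, hζ, map_zero]
    have hn : ∀ n : ℕ, starRingEnd ℂ ρ ≠ -n := by
      intro n hn
      have := congrArg Complex.im hn
      simp at this
      linarith
    have hne1 : starRingEnd ℂ ρ ≠ 1 := by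
      intro h1'
      have := congrArg Complex.im h1'
      simp at this
      linarith
    have hz : riemannZeta (1 - starRingEnd ℂ ρ) = 0 := by
      rw [riemannZeta_one_sub hn hne1, hc, mul_zero]
    refine h (1 - ρ.re) (by linarith) (by linarith) ?_
    have : ((1 - ρ.re : ℝ) : ℂ) + T * I = 1 - starRingEnd ℂ ρ := by
      apply Complex.ext <;> simp [hρT]
    rwa [this]

/-! ## The vertical leg: `Im (i ∫₀ᵀ ζ'/ζ(2+iy) dy) = arg ζ(2+iT)` -/

/-- Along `Re s = 2`, where `Re ζ > 0`, the change of argument is the principal argument: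
`Im (i∫₀ᵀ (ζ'/ζ)(2+iy) dy) = arg ζ(2 + iT)`. [folklore] -/
theorem im_I_mul_integral_logDeriv_zeta_two {T : ℝ} (hT : 0 ≤ T) :
    (I * ∫ y in (0 : ℝ)..T, deriv riemannZeta (2 + y * I) / riemannZeta (2 + y * I)).im =
      arg (riemannZeta (2 + T * I)) := by
  have hf : ∀ y ∈ Icc 0 T, AnalyticAt ℂ riemannZeta (2 + y * I) := fun y _ ↦
    analyticOn_riemannZeta _ (by
      intro h; have := congrArg Complex.re h; simp at this)
  have hd : ∀ y ∈ Icc 0 T, 0 < (qrot 0 * riemannZeta (2 + y * I)).re := fun y _ ↦ by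
    rw [show qrot 0 = 1 from rfl, one_mul]; exact re_riemannZeta_two_add_pos y
  have h := integral_logDeriv_vpiece (f := riemannZeta) (x := 2) hT hf hd
  rw [show qrot 0 = 1 from rfl, one_mul, one_mul] at h
  push_cast at h
  rw [h, sub_im, Complex.log_im, Complex.log_im]
  have h2 : arg (riemannZeta (2 + 0 * I)) = 0 := by
    rw [zero_mul, add_zero]
    have hre : 0 < (riemannZeta 2).re := by simpa using re_riemannZeta_two_add_pos 0
    have him : (riemannZeta 2).im = 0 := by
      have := riemannZeta_conj 2
      rw [show starRingEnd ℂ (2 : ℂ) = 2 by simp [map_ofNat]] at this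
      -- ζ(2) = conj ζ(2)
      have h' := congrArg Complex.im this
      simp at h'
      linarith
    exact Complex.arg_eq_zero_iff.2 ⟨hre.le, him⟩
  rw [h2, sub_zero]

/-! ## The zero count from a certified piece list -/

/-- **`N(T)` from a certified change of argument.** Let `T > 0` and let
`(x₁, d₁) :: L` be a valid piece list (`Literature.Analysis.Complex.HPieces`) for `ζ` along the horizontal
segment from `½ + iT` to `2 + iT` (so on each closed piece `ζ` takes values in the open
half-plane with label `d`), ending with label `0` (`Re ζ(2+iT) > 0` holds anyway). Then `T` is
not the ordinate of a zero, the exact Riemann–von Mangoldt formula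
`N(T) = θ(T)/π + 1 + S(T)` with
`π S(T) = arg (i^{-d₁} ζ(½+iT)) − (π/2) · turns` (`|arg| < π/2`) holds, and hence
`|N(T) − (θ(T)/π + 1 − turns/2)| < ½`: the integer `N(T)` is determined by an enclosure of
`θ(T)` and the number of signed quarter turns of the certificate. [cite: Titchmarsh1986, Thm. 9.3 and §9.3 (9.3.2)] -/
theorem abs_zetaZeroCount_sub_lt_of_hpieces {T x₁ : ℝ} (hT : 0 < T) {d₁ : Fin 4}
    {L : List (ℝ × Fin 4)} (hP : HPieces riemannZeta T (1 / 2) ((x₁, d₁) :: L))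
    (hlast : piecesLast x₁ L = 2) (hdir : piecesLastDir d₁ L = 0) :
    |(zetaZeroCount T : ℝ) - (riemannSiegelTheta T / π + 1 - (piecesTurns d₁ L : ℝ) / 2)| <
      1 / 2 := by
  -- `ζ ≠ 0` on the segment, hence `T` is not an ordinate
  have hne : ∀ x : ℝ, 1 / 2 ≤ x → x < 1 → riemannZeta (x + T * I) ≠ 0 := by
    intro x hx hx1
    have := hP.ne_zero x ⟨hx, ?_⟩ (by simp)
    · exact this
    · simp only [piecesLast_cons, hlast]; linarith
  have hord := no_ordinate_of_ne_zero_on_segment hT hne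
  -- the exact formula for `π S(T)`
  have hS := pi_mul_zetaArgS_eq hT hord
  -- evaluate the horizontal leg with the certificate
  have hanal : ∀ x ∈ Icc (1 / 2 : ℝ) (piecesLast x₁ L), AnalyticAt ℂ riemannZeta (x + T * I) :=
    fun x _ ↦ analyticOn_riemannZeta _ (by
      intro h; have := congrArg Complex.im h; simp at this; exact hT.ne' this)
  have hH := integral_logDeriv_hpieces hP hanal
  rw [hlast, hdir, show qrot 0 = 1 from rfl, one_mul] at hH
  rw [im_I_mul_integral_logDeriv_zeta_two hT.le, hH] at hS
  -- simplify imaginary parts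
  have hI2 : ((piecesTurns d₁ L : ℂ) * (π / 2) * I).im = (piecesTurns d₁ L : ℝ) * (π / 2) := by
    simp [Complex.mul_im]
  rw [add_im, sub_im, Complex.log_im, Complex.log_im, hI2] at hS
  -- `|arg (qrot d₁ ζ(1/2+iT))| < π/2`
  have hpos : 0 < (qrot d₁ * riemannZeta (1 / 2 + T * I)).re := by
    have := hP.2.1 (1 / 2) ⟨le_rfl, hP.1⟩
    push_cast at this
    exact this
  have harg : |arg (qrot d₁ * riemannZeta (1 / 2 + T * I))| < π / 2 :=
    Complex.abs_arg_lt_pi_div_two_iff.2 (Or.inl hpos)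
  -- `N = S + θ/π + 1`
  have hN : (zetaZeroCount T : ℝ) = zetaArgS T + riemannSiegelTheta T / π + 1 := by
    rw [zetaArgS]; ring
  have hπ := Real.pi_pos
  -- from `π S = arg ζ(2+iT) − (arg ζ(2+iT) − arg(q₁ζ(½+iT)) + turns π/2)`
  push_cast at hS
  have hS2 : π * zetaArgS T =
      arg (qrot d₁ * riemannZeta (1 / 2 + T * I)) - (piecesTurns d₁ L : ℝ) * (π / 2) := by
    rw [hS]; ring
  have hS' : zetaArgS T = (arg (qrot d₁ * riemannZeta (1 / 2 + T * I))) / π -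
      (piecesTurns d₁ L : ℝ) / 2 := by
    apply mul_left_cancel₀ hπ.ne'
    rw [hS2]
    field_simp
  rw [hN, hS']
  have h1 : |arg (qrot d₁ * riemannZeta (1 / 2 + T * I)) / π| < 1 / 2 := by
    rw [abs_div, abs_of_pos hπ, div_lt_iff₀ hπ]
    linarith
  have e : arg (qrot d₁ * riemannZeta (1 / 2 + T * I)) / π - (piecesTurns d₁ L : ℝ) / 2 +
      riemannSiegelTheta T / π + 1 - (riemannSiegelTheta T / π + 1 - (piecesTurns d₁ L : ℝ) / 2) =
      arg (qrot d₁ * riemannZeta (1 / 2 + T * I)) / π := by ring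
  rw [e]
  exact h1

/-- **Corollary: the exact count.** With the data of `abs_zetaZeroCount_sub_lt_of_hpieces`, if an
integer `n` satisfies `|θ(T)/π + 1 − turns/2 − n| ≤ ½` then `N(T) = n`. [cite: Titchmarsh1986, Thm. 9.3] -/
theorem ZetaZeroCountCertificate.zetaZeroCount_eq_of_hpieces {T x₁ : ℝ} (hT : 0 < T) {d₁ : Fin 4}
    {L : List (ℝ × Fin 4)} (hP : HPieces riemannZeta T (1 / 2) ((x₁, d₁) :: L))
    (hlast : piecesLast x₁ L = 2) (hdir : piecesLastDir d₁ L = 0) {n : ℕ}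
    (hn : |riemannSiegelTheta T / π + 1 - (piecesTurns d₁ L : ℝ) / 2 - n| ≤ 1 / 2) :
    zetaZeroCount T = n := by
  have h := abs_zetaZeroCount_sub_lt_of_hpieces hT hP hlast hdir
  have hlt : |(zetaZeroCount T : ℝ) - n| < 1 := by
    have := abs_sub_le ((zetaZeroCount T : ℝ))
      (riemannSiegelTheta T / π + 1 - (piecesTurns d₁ L : ℝ) / 2) (n : ℝ)
    linarith
  obtain ⟨hlt1, hlt2⟩ := abs_sub_lt_iff.1 hlt
  have h1 : (zetaZeroCount T : ℝ) < n + 1 := by linarith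
  have h2 : (n : ℝ) < zetaZeroCount T + 1 := by linarith
  have h1' : zetaZeroCount T < n + 1 := by exact_mod_cast h1
  have h2' : n < zetaZeroCount T + 1 := by exact_mod_cast h2
  omega

/-- The same with the explicit Stirling bound for `θ(T)` (`abs_riemannSiegelTheta_sub_stirling_le`,
`T ≥ 2`): an enclosure of the elementary main term `(T/2) log(T/2π) − T/2 − π/8` to within
`½ − 2K(¼)/T` of `π(n − 1 + turns/2)` pins `N(T) = n`. [cite: Titchmarsh1986, Thm. 9.3 and §4.17] -/
theorem ZetaZeroCountCertificate.zetaZeroCount_eq_of_hpieces_stirling {T x₁ : ℝ} (hT : 2 ≤ T) {d₁ : Fin 4}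
    {L : List (ℝ × Fin 4)} (hP : HPieces riemannZeta T (1 / 2) ((x₁, d₁) :: L))
    (hlast : piecesLast x₁ L = 2) (hdir : piecesLastDir d₁ L = 0) {n : ℕ}
    (hn : |(T / 2 * Real.log (T / (2 * π)) - T / 2 - π / 8) / π + 1 -
        (piecesTurns d₁ L : ℝ) / 2 - n| ≤ 1 / 2 - 2 * stirlingVertRate (1 / 4) / T / π) :
    zetaZeroCount T = n := by
  refine ZetaZeroCountCertificate.zetaZeroCount_eq_of_hpieces (by linarith) hP hlast hdir ?_
  have hθ := abs_riemannSiegelTheta_sub_stirling_le hT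
  have hπ := Real.pi_pos
  have hdiv : |riemannSiegelTheta T / π - (T / 2 * Real.log (T / (2 * π)) - T / 2 - π / 8) / π| ≤
      2 * stirlingVertRate (1 / 4) / T / π := by
    rw [← sub_div, abs_div, abs_of_pos hπ]
    exact div_le_div_of_nonneg_right hθ hπ.le
  have := abs_sub_le (riemannSiegelTheta T / π + 1 - (piecesTurns d₁ L : ℝ) / 2 - n)
    ((T / 2 * Real.log (T / (2 * π)) - T / 2 - π / 8) / π + 1 - (piecesTurns d₁ L : ℝ) / 2 - n) 0
  simp only [sub_zero] at this
  have e : riemannSiegelTheta T / π + 1 - (piecesTurns d₁ L : ℝ) / 2 - n -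
      ((T / 2 * Real.log (T / (2 * π)) - T / 2 - π / 8) / π + 1 - (piecesTurns d₁ L : ℝ) / 2 - n) =
      riemannSiegelTheta T / π - (T / 2 * Real.log (T / (2 * π)) - T / 2 - π / 8) / π := by ring
  rw [e] at this
  linarith

end Literature.NumberTheory.LFunctions

end
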